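import Summits.SmoothPoincare4.SmoothPoincare4.Theorems.SymplecticOrigamiGromovRecognitionRelEndWindLinAlg
import Mathlib.LinearAlgebra.Alternating.Curry
import Mathlib.LinearAlgebra.Determinant
import Mathlib.LinearAlgebra.Complex.FiniteDimensional
import Mathlib.LinearAlgebra.FiniteDimensional.Lemmas

/-!
# The frame-determinant identity at a transverse crossing of two surfaces
(registered helper `helper_detFrameIdentity` of the stub `stub_normalWitnessTransfer`, line
`cross-cap-laurent`, crux `GromovRecognitionRelEnd`, item stmt-SmoothPoincare4-11009)

Setting: a real vector space `E` with a basis `b` indexed by `Fin 4` (`b.det` is the associated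
determinant `4`-form), four real-linear maps `α β N L : ℂ → E` (`ℂ` being the real plane with
basis `(1, I)`) and two real-linear maps `lam mu : E → ℂ` with `lam ∘ α = 0`, `lam ∘ N = id`,
`mu ∘ β = 0`, `mu ∘ L = id`.  Claim (`helper_detFrameIdentity`):
`b.det (α 1, α I, N 1, N I) · det (lam ∘ β) = b.det (β 1, β I, L 1, L I) · det (mu ∘ α)`,
where `det` is the determinant of a real-linear self-map of `ℂ`
(`det T = Re (T 1) Im (T I) - Re (T I) Im (T 1)`, `det_realLinear_complex_eq`).

Proof (elementary exterior algebra: expansion of an alternating form along a direct-sum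
decomposition, N. Bourbaki, *Algebra I*, Chapter III, §7–§8).  Both sides are shown to equal
`b.det (α 1, α I, β 1, β I)`.
* `det_frame_mul_det`: `b.det (α 1, α I, N 1, N I) · det (lam ∘ β) = b.det (α 1, α I, β 1, β I)`.
  If `α` is not injective, `α 1, α I` are linearly dependent, so both `4`-frames are degenerate
  and both sides vanish (`AlternatingMap.map_linearDependent`).  If `α` is injective, then
  `range α = ker lam`: `range α ≤ ker lam` and both have dimension `2` (`lam` is onto, `E` has
  dimension `4`); hence every `e : E` decomposes as `e = α a + N (lam e)`.  Expanding `β 1` and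
  `β I` this way in the last two slots of `b.det (α 1, α I, ·, ·)`, the `α`-components die by
  alternation, and writing `N y = Re y • N 1 + Im y • N I` the `N`-components contribute
  `(Re y₁ Im y₂ - Re y₂ Im y₁) · b.det (α 1, α I, N 1, N I)` with `y₁ = lam (β 1)`,
  `y₂ = lam (β I)`, i.e. `det (lam ∘ β) · b.det (α 1, α I, N 1, N I)`.
* Symmetrically `b.det (β 1, β I, L 1, L I) · det (mu ∘ α) = b.det (β 1, β I, α 1, α I)`, and the
  even permutation `(0 2)(1 3)` of the slots identifies the two right-hand sides.
No new definitions.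
-/

-- the prescribed namespace `Summit.<P>.<Sub>.…` duplicates `SmoothPoincare4` (P = Sub)
set_option linter.dupNamespace false

open Module

namespace Summit.SmoothPoincare4.SmoothPoincare4.Theorems.GromovRecognitionRelEnd.CrossCapLaurent

namespace HelperDetFrameIdentity

variable {E : Type*} [AddCommGroup E] [Module ℝ E]

/-- A real-linear map out of `ℂ` is determined by its values at `1` and `I`:
`T z = Re z • T 1 + Im z • T I`. [folklore] -/
theorem apply_eq_re_im (T : ℂ →ₗ[ℝ] E) (z : ℂ) :
    T z = z.re • T 1 + z.im • T Complex.I := by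
  rw [← T.map_smul, ← T.map_smul, ← T.map_add, Complex.real_smul, Complex.real_smul, mul_one,
    Complex.re_add_im]

/-- Expansion of an alternating `2`-form on two combinations of two vectors:
`g (a n + b m, c n + d m) = (a d - c b) g (n, m)`. [folklore] -/
theorem two_form_expand (g : E [⋀^Fin 2]→ₗ[ℝ] ℝ) (n m : E) (a b c d : ℝ) :
    g ![a • n + b • m, c • n + d • m] = (a * d - c * b) * g ![n, m] := by
  have hadd : ∀ p q q' : E, g ![p, q + q'] = g ![p, q] + g ![p, q'] := fun p q q' =>
    (g.curryLeft p).map_vecCons_add ![] q q'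
  have hsmul : ∀ (p q : E) (r : ℝ), g ![p, r • q] = r • g ![p, q] := fun p q r =>
    (g.curryLeft p).map_vecCons_smul ![] r q
  have hdiag : ∀ p : E, g ![p, p] = 0 := fun p =>
    g.map_eq_zero_of_eq _ (i := 0) (j := 1) rfl zero_ne_one
  have hswap : g ![m, n] = -g ![n, m] := by
    rw [← g.map_swap ![n, m] (i := 0) (j := 1) zero_ne_one]
    congr 1
    ext i
    fin_cases i <;> rfl
  rw [g.map_vecCons_add, g.map_vecCons_smul, g.map_vecCons_smul, hadd, hsmul, hsmul, hadd, hsmul,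
    hsmul, hdiag, hdiag, hswap]
  simp only [smul_eq_mul]
  ring

/-- Expansion of an alternating `4`-form `f (α 1, α I, ·, ·)` on two vectors `α aₖ + N yₖ`:
the `α`-components die by alternation and the `N`-components contribute the `2 × 2` determinant
`Re y₁ Im y₂ - Re y₂ Im y₁` times `f (α 1, α I, N 1, N I)`. [folklore] -/
theorem four_form_expand (f : E [⋀^Fin 4]→ₗ[ℝ] ℝ) (α N : ℂ →ₗ[ℝ] E) (a₁ a₂ y₁ y₂ : ℂ) :
    f ![α 1, α Complex.I, α a₁ + N y₁, α a₂ + N y₂]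
      = (y₁.re * y₂.im - y₂.re * y₁.im) * f ![α 1, α Complex.I, N 1, N Complex.I] := by
  set g : E [⋀^Fin 2]→ₗ[ℝ] ℝ := (f.curryLeft (α 1)).curryLeft (α Complex.I) with hg
  have hfg : ∀ p q : E, f ![α 1, α Complex.I, p, q] = g ![p, q] := fun p q => rfl
  have hadd : ∀ p q q' : E, g ![p, q + q'] = g ![p, q] + g ![p, q'] := fun p q q' =>
    (g.curryLeft p).map_vecCons_add ![] q q'
  have hsmul : ∀ (p q : E) (r : ℝ), g ![p, r • q] = r • g ![p, q] := fun p q r =>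
    (g.curryLeft p).map_vecCons_smul ![] r q
  -- the `α`-components are killed by the first two slots
  have hα₁ : ∀ (a : ℂ) (q : E), g ![α a, q] = 0 := by
    intro a q
    rw [apply_eq_re_im α a, g.map_vecCons_add, g.map_vecCons_smul, g.map_vecCons_smul, ← hfg,
      ← hfg, f.map_eq_zero_of_eq _ (i := 0) (j := 2) rfl (by decide),
      f.map_eq_zero_of_eq _ (i := 1) (j := 2) rfl (by decide), smul_zero, smul_zero, add_zero]
  have hα₂ : ∀ (p : E) (a : ℂ), g ![p, α a] = 0 := by
    intro p a
    rw [apply_eq_re_im α a, hadd, hsmul, hsmul, ← hfg, ← hfg,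
      f.map_eq_zero_of_eq _ (i := 0) (j := 3) rfl (by decide),
      f.map_eq_zero_of_eq _ (i := 1) (j := 3) rfl (by decide), smul_zero, smul_zero, add_zero]
  rw [hfg, hfg, g.map_vecCons_add, hα₁, zero_add, hadd, hα₂, zero_add, apply_eq_re_im N y₁,
    apply_eq_re_im N y₂, two_form_expand]

/-- Two disjoint transpositions of the slots do not change the value of an alternating `4`-form:
`f (c, d, a, b) = f (a, b, c, d)`. [folklore] -/
theorem four_form_swap_pairs (f : E [⋀^Fin 4]→ₗ[ℝ] ℝ) (a b c d : E) :
    f ![c, d, a, b] = f ![a, b, c, d] := by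
  have h1 : f ![c, b, a, d] = -f ![a, b, c, d] := by
    rw [← f.map_swap ![a, b, c, d] (i := 0) (j := 2) (by decide)]
    congr 1
    ext i
    fin_cases i <;> rfl
  have h2 : f ![c, d, a, b] = -f ![c, b, a, d] := by
    rw [← f.map_swap ![c, b, a, d] (i := 1) (j := 3) (by decide)]
    congr 1
    ext i
    fin_cases i <;> rfl
  rw [h2, h1, neg_neg]

/-- If a real-linear `α : ℂ → E` is not injective, every `4`-frame starting with `α 1, α I` is
linearly dependent. [folklore] -/
theorem not_linearIndependent_of_not_injective (α : ℂ →ₗ[ℝ] E) (hα : ¬ Function.Injective α)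
    (p q : E) : ¬ LinearIndependent ℝ ![α 1, α Complex.I, p, q] := by
  obtain ⟨z, hz0, hz⟩ : ∃ z : ℂ, α z = 0 ∧ z ≠ 0 := by
    by_contra h
    push Not at h
    exact hα ((injective_iff_map_eq_zero α).2 h)
  rw [Fintype.not_linearIndependent_iff]
  refine ⟨![z.re, z.im, 0, 0], ?_, ?_⟩
  · rw [apply_eq_re_im α z] at hz0
    simpa [Fin.sum_univ_four] using hz0
  · by_contra h
    push Not at h
    exact hz (Complex.ext (by simpa using h 0) (by simpa using h 1))

/-- One half of the frame identity: if `lam ∘ α = 0` and `lam ∘ N = id`, then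
`b.det (α 1, α I, N 1, N I) · det (lam ∘ β) = b.det (α 1, α I, β 1, β I)`. [folklore] -/
theorem det_frame_mul_det (b : Module.Basis (Fin 4) ℝ E) (α β N : ℂ →ₗ[ℝ] E) (lam : E →ₗ[ℝ] ℂ)
    (hα : lam ∘ₗ α = 0) (hN : lam ∘ₗ N = LinearMap.id) :
    b.det ![α 1, α Complex.I, N 1, N Complex.I] * LinearMap.det (lam ∘ₗ β)
      = b.det ![α 1, α Complex.I, β 1, β Complex.I] := by
  by_cases hinj : Function.Injective α
  · -- `range α = ker lam`, so every vector decomposes as `α a + N (lam e)`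
    haveI : FiniteDimensional ℝ E := Module.Finite.of_basis b
    have hE : finrank ℝ E = 4 := by simpa using finrank_eq_card_basis b
    have hNl : ∀ y : ℂ, lam (N y) = y := fun y => by
      simpa using LinearMap.congr_fun hN y
    have hsurj : Function.Surjective lam := fun y => ⟨N y, hNl y⟩
    have hrange : LinearMap.range α = LinearMap.ker lam := by
      apply Submodule.eq_of_le_of_finrank_eq (LinearMap.range_le_ker_iff.2 hα)
      have h1 : finrank ℝ (LinearMap.range α) = 2 := by
        rw [LinearMap.finrank_range_of_inj hinj, Complex.finrank_real_complex]
      have h2 := LinearMap.finrank_range_add_finrank_ker lam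
      rw [LinearMap.range_eq_top.2 hsurj, finrank_top, hE, Complex.finrank_real_complex] at h2
      omega
    have hdec : ∀ e : E, ∃ a : ℂ, e = α a + N (lam e) := by
      intro e
      have hmem : e - N (lam e) ∈ LinearMap.ker lam := by
        rw [LinearMap.mem_ker, map_sub, hNl, sub_self]
      rw [← hrange, LinearMap.mem_range] at hmem
      obtain ⟨a, ha⟩ := hmem
      exact ⟨a, by rw [ha, sub_add_cancel]⟩
    obtain ⟨a₁, h₁⟩ := hdec (β 1)
    obtain ⟨a₂, h₂⟩ := hdec (β Complex.I)
    have key := four_form_expand b.det α N a₁ a₂ (lam (β 1)) (lam (β Complex.I))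
    rw [← h₁, ← h₂] at key
    rw [key, det_realLinear_complex_eq]
    simp only [LinearMap.coe_comp, Function.comp_apply]
    ring
  · -- `α 1, α I` are linearly dependent: both frames are degenerate
    rw [b.det.map_linearDependent _ (not_linearIndependent_of_not_injective α hinj _ _),
      b.det.map_linearDependent _ (not_linearIndependent_of_not_injective α hinj _ _), zero_mul]

end HelperDetFrameIdentity

open HelperDetFrameIdentity in
/-- **Frame-determinant identity at a transverse crossing.**  For real-linear
`α β N L : ℂ → E`, `lam mu : E → ℂ` with `lam ∘ α = 0`, `lam ∘ N = id`, `mu ∘ β = 0`,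
`mu ∘ L = id` and a basis `b` of the real `4`-space `E`:
`b.det (α 1, α I, N 1, N I) · det (lam ∘ β) = b.det (β 1, β I, L 1, L I) · det (mu ∘ α)`
(both sides equal `b.det (α 1, α I, β 1, β I)`). -/
theorem helper_detFrameIdentity : ∀ (E : Type) [AddCommGroup E] [Module ℝ E] (b : Module.Basis (Fin 4) ℝ E) (α β N L : ℂ →ₗ[ℝ] E) (lam mu : E →ₗ[ℝ] ℂ), lam ∘ₗ α = 0 → lam ∘ₗ N = LinearMap.id → mu ∘ₗ β = 0 → mu ∘ₗ L = LinearMap.id → b.det ![α 1, α Complex.I, N 1, N Complex.I] * LinearMap.det (lam ∘ₗ β) = b.det ![β 1, β Complex.I, L 1, L Complex.I] * LinearMap.det (mu ∘ₗ α) := by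
  intro E _ _ b α β N L lam mu hα hN hβ hL
  rw [det_frame_mul_det b α β N lam hα hN, det_frame_mul_det b β α L mu hβ hL,
    four_form_swap_pairs]

end Summit.SmoothPoincare4.SmoothPoincare4.Theorems.GromovRecognitionRelEnd.CrossCapLaurent
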